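import Mathlib
import HarnessLib
import Summits.NavierStokesRegularity.NavierStokesRegularity.Theorems.CompletionRelayChainPhaseISoundArith
import Summits.NavierStokesRegularity.NavierStokesRegularity.Theorems.CompletionRelayChainPhaseIBlockRows

/-!
# Route `CompletionRelayChain` — crux `RelayFrontStep` (stmt-NavierStokesRegularity-24850), K-side of `stub_phaseI`,
  work package K5-b: THE CHECKER'S COEFFICIENT LIST ENCLOSES THE RELAY BLOCK FIELD

* `enc : BIdx → Fin 19`, `ext` (the block state extended by the constant coordinate `w = 1` at index `18`);
* `coefsR` — the real coefficient list: the 42 relay entries (`relayCoefs`, p618744) re-indexed by `enc`, plus the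
  forcing centre `(x₋₃, w, w, FR0)`; `encl_coefs : Encl coefsQ coefsR` (the `√2` bounds of `…PhaseISoundArith`);
* `fieldR := bilinOfCoefs coefsR` on `Fin 19 → ℝ` and `fieldR_ext`: on an extended block state it is `relayQ` plus the
  forcing centre on `ẋ₋₃`, and `0` on `w`.
MODEL-lattice bookkeeping (rung TL-M3-R64); nothing here is a statement about the Navier–Stokes equations.
-/

noncomputable section

set_option linter.dupNamespace false

namespace Summit.NavierStokesRegularity.NavierStokesRegularity.Cruxes.RelayFrontStep.PhaseI

open Checker

/-! ### Indexing -/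

/-- Block index `(s, i) ↦ 3s + i ∈ Fin 19`. [this file] -/
def enc (d : BIdx) : Fin 19 := ⟨3 * d.1.val + d.2.val, by have := d.1.isLt; have := d.2.isLt; omega⟩

/-- `enc` is injective. [this file] -/
theorem enc_injective : Function.Injective enc := by
  rintro ⟨s, i⟩ ⟨s', i'⟩ h
  simp only [enc, Fin.mk.injEq] at h
  have hs : s.val = s'.val := by have := i.isLt; have := i'.isLt; omega
  have hi : i.val = i'.val := by omega
  exact Prod.ext (Fin.ext hs) (Fin.ext hi)

/-- `enc d ≠ 18`. [this file] -/
theorem enc_val_lt (d : BIdx) : (enc d).val < 18 := by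
  have := d.1.isLt; have := d.2.isLt; simp only [enc]; omega

/-- The block state extended by the constant coordinate `w = 1` (index `18`). [this file] -/
def ext (y : BIdx → ℝ) : Fin 19 → ℝ := fun c =>
  if h : c.val < 18 then y (⟨c.val / 3, by omega⟩, ⟨c.val % 3, Nat.mod_lt _ (by norm_num)⟩) else 1

/-- `ext y (enc d) = y d`. [this file] -/
@[simp] theorem ext_enc (y : BIdx → ℝ) (d : BIdx) : ext y (enc d) = y d := by
  obtain ⟨s, i⟩ := d
  have hs := s.isLt; have hi := i.isLt
  simp only [ext, enc, dif_pos (show 3 * s.val + i.val < 18 by omega)]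
  congr 1
  refine Prod.ext (Fin.ext ?_) (Fin.ext ?_)
  · show (3 * s.val + i.val) / 3 = s.val
    omega
  · show (3 * s.val + i.val) % 3 = i.val
    omega

/-- `ext y 18 = 1`. [this file] -/
@[simp] theorem ext_last (y : BIdx → ℝ) : ext y (18 : Fin 19) = 1 := by
  simp [ext]

/-- Every index below `18` is an `enc`. [this file] -/
theorem exists_enc_of_lt {c : Fin 19} (hc : c.val < 18) : ∃ d : BIdx, enc d = c :=
  ⟨(⟨c.val / 3, by omega⟩, ⟨c.val % 3, Nat.mod_lt _ (by norm_num)⟩), by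
    apply Fin.ext; simp only [enc]; omega⟩

/-! ### The real coefficient list -/

/-- Re-index a relay entry by `enc`. [this file] -/
def liftE (e : BIdx × BIdx × BIdx × ℝ) : Fin 19 × Fin 19 × Fin 19 × ℝ := (enc e.1, enc e.2.1, enc e.2.2.1, e.2.2.2)

/-- The real coefficient list of the checker's field: the relay block entries and the forcing centre `FR0·w·w` on
`ẋ₋₃`. [this file] -/
def coefsR : List (Fin 19 × Fin 19 × Fin 19 × ℝ) :=
  relayCoefs.map liftE ++ [((0 : Fin 19), (18 : Fin 19), (18 : Fin 19), ((FR0 : ℚ) : ℝ))]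

/-- The real bilinear field of the checker on `Fin 19 → ℝ`. [this file] -/
def fieldR : (Fin 19 → ℝ) →ₗ[ℝ] (Fin 19 → ℝ) →ₗ[ℝ] Fin 19 → ℝ := bilinOfCoefs coefsR

/-- **The rational intervals of `coefsQ` enclose the real coefficients of `coefsR`**, entry by entry. [this file] -/
theorem encl_coefs : Encl coefsQ coefsR := by
  have h1 := sqrt_two_ge
  have h2 := sqrt_two_le
  unfold Encl coefsQ coefsR relayCoefs liftE
  simp only [List.map_cons, List.map_nil, List.cons_append, List.nil_append, List.forall₂_cons,
    List.Forall₂.nil, and_true, lam_neg_three, lam_neg_two, lam_neg_one, lam_zero', lam_one, lam_two]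
  refine ⟨?_, ?_, ?_, ?_, ?_, ?_, ?_, ?_, ?_, ?_, ?_, ?_, ?_, ?_, ?_, ?_, ?_, ?_, ?_, ?_, ?_, ?_, ?_, ?_, ?_, ?_, ?_, ?_,
    ?_, ?_, ?_, ?_, ?_, ?_, ?_, ?_, ?_, ?_, ?_, ?_, ?_, ?_, ?_⟩
  all_goals
    refine ⟨by decide, by decide, by decide, ?_, ?_⟩ <;> push_cast <;>
      first | (norm_num [FR0, Checker.Tstar]; done) | nlinarith [h1, h2]

/-! ### The field on extended block states -/

/-- Summand of `bilinOfCoefs_apply` for a lifted entry at an extended state and an encoded component. [this file] -/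
theorem summand_liftE (y : BIdx → ℝ) (d : BIdx) (e : BIdx × BIdx × BIdx × ℝ) :
    (if enc d = (liftE e).1 then (liftE e).2.2.2 * (ext y (liftE e).2.1 * ext y (liftE e).2.2.1) else 0) =
      (if d = e.1 then e.2.2.2 * (y e.2.1 * y e.2.2.1) else 0) := by
  simp only [liftE, ext_enc, enc_injective.eq_iff]

/-- **On an extended block state the checker's field is the relay field plus the forcing centre** (component `enc d`).
[this file] -/
theorem fieldR_ext_enc (y : BIdx → ℝ) (d : BIdx) :
    fieldR (ext y) (ext y) (enc d) = relayQ y y d + (if d = ((0 : Fin 6), (0 : Fin 3)) then ((FR0 : ℚ) : ℝ) else 0) := by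
  rw [fieldR, relayQ_def, bilinOfCoefs_apply, bilinOfCoefs_apply, coefsR, List.map_append, List.sum_append,
    List.map_map]
  congr 1
  · congr 1
    refine List.map_congr_left fun e _ => ?_
    exact summand_liftE y d e
  · have h18 : enc d ≠ (18 : Fin 19) := fun h => by
      have := enc_val_lt d; rw [h] at this; exact absurd this (by decide)
    have h0 : (enc d = (0 : Fin 19)) ↔ d = ((0 : Fin 6), (0 : Fin 3)) := by
      constructor
      · intro h
        have : enc d = enc ((0 : Fin 6), (0 : Fin 3)) := by rw [h]; decide
        exact enc_injective this
      · rintro rfl; decide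
    simp only [List.map_cons, List.map_nil, List.sum_cons, List.sum_nil, add_zero, ext_last, mul_one]
    by_cases hd : d = ((0 : Fin 6), (0 : Fin 3))
    · rw [if_pos (h0.2 hd), if_pos hd]
    · rw [if_neg (fun h => hd (h0.1 h)), if_neg hd]

/-- On the constant coordinate the field vanishes. [this file] -/
theorem fieldR_last (u v : Fin 19 → ℝ) : fieldR u v (18 : Fin 19) = 0 := by
  rw [fieldR, bilinOfCoefs_apply, coefsR, List.map_append, List.sum_append, List.map_map]
  have hA : ∀ e ∈ relayCoefs, ((fun e : Fin 19 × Fin 19 × Fin 19 × ℝ =>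
      if (18 : Fin 19) = e.1 then e.2.2.2 * (u e.2.1 * v e.2.2.1) else 0) ∘ liftE) e = 0 := by
    intro e _
    have : (18 : Fin 19) ≠ enc e.1 := fun h => by
      have := enc_val_lt e.1; rw [← h] at this; exact absurd this (by decide)
    simp [liftE, this]
  rw [List.map_congr_left hA]
  simp

end Summit.NavierStokesRegularity.NavierStokesRegularity.Cruxes.RelayFrontStep.PhaseI

end
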